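import Mathlib.GroupTheory.Index
import Mathlib.GroupTheory.QuotientGroup.Basic
import Mathlib.Data.Fintype.Card
import HarnessLib

/-!
# Index three from two classes of "bad" elements (tool for the local index of types `IV`, `IV*`)

Abstract group theory behind `c = 3` in Tate's algorithm, Steps 5 and 8 (Silverman, *ATAEC*,
IV.9.4; Table 4.1: component group `ℤ/3ℤ` for types `IV`, `IV*`). Let `H` be a subgroup of an
abelian group `G` (in the application: `E₀(K) ≤ E(K)`) and suppose the elements outside `H`
("bad points") carry a two-valued label `cls` (the root `ȳ/πʲ ∈ {r₁, r₂}` of the quadratic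
`Y² + a₃,ⱼY − a₆,₂ⱼ`) such that

* the negative of a bad element is bad with the other label (`hneg`);
* the sum of two bad elements with the same label is bad with the other label (`hsame`).

Then the sum of two bad elements with different labels lies in `H` (`add_mem_of_cls_ne`: if
`S = x + y` were bad, `S + x = 2x + y` resp. `S + y = x + 2y` would carry both labels), and if
there is a bad element at all, `[G : H] = 3` (`index_eq_three_of_cls`: the classes are
`0, [x₀], −[x₀]`). No finiteness is assumed; it follows.

## References

* J. H. Silverman, *Advanced Topics in the Arithmetic of Elliptic Curves*, GTM 151, Springer
  1994, IV.9.4 Steps 5 and 8 and Table 4.1. [SilvermanATAEC1994]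
-/

namespace Literature.NumberTheory.EllipticCurves

namespace LocalIndex

variable {G : Type*} [AddCommGroup G] (H : AddSubgroup G) (cls : G → Bool)

/-- **Different labels add up into `H`.** [folklore] -/
theorem add_mem_of_cls_ne
    (hsame : ∀ x y, x ∉ H → y ∉ H → cls x = cls y → x + y ∉ H ∧ cls (x + y) = !cls x)
    {x y : G} (hx : x ∉ H) (hy : y ∉ H) (hcls : cls x ≠ cls y) : x + y ∈ H := by
  by_contra hS
  have hyx : cls y = !cls x := by
    cases h : cls x <;> cases h' : cls y <;> simp_all
  obtain ⟨hxx, hcxx⟩ := hsame x x hx hx rfl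
  obtain ⟨hyy, hcyy⟩ := hsame y y hy hy rfl
  by_cases hSx : cls (x + y) = cls x
  · -- `S + x = (x + x) + y` carries both labels
    obtain ⟨-, h1⟩ := hsame (x + y) x hS hx hSx
    obtain ⟨-, h2⟩ := hsame (x + x) y hxx hy (by rw [hcxx, hyx])
    have e : x + y + x = x + x + y := add_right_comm x y x
    rw [e, h2, hcxx, hSx] at h1
    cases h : cls x <;> simp [h] at h1
  · have hSy : cls (x + y) = cls y := by
      cases h : cls x <;> cases h' : cls (x + y) <;> simp_all
    obtain ⟨-, h1⟩ := hsame (x + y) y hS hy hSy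
    obtain ⟨-, h2⟩ := hsame x (y + y) hx hyy (by rw [hcyy, hyx, Bool.not_not])
    have e : x + y + y = x + (y + y) := add_assoc x y y
    rw [e, h2, hSy, hyx] at h1
    cases h : cls x <;> simp [h] at h1

/-- **Index three.** If moreover negation swaps the labels and some element lies outside `H`, then
`H` has index `3`: every class of `G/H` is `0`, `[x₀]` or `−[x₀]`, and these are distinct
(`x₀ + x₀ ∉ H`). [folklore] -/
theorem index_eq_three_of_cls (hneg : ∀ x, x ∉ H → -x ∉ H ∧ cls (-x) = !cls x)
    (hsame : ∀ x y, x ∉ H → y ∉ H → cls x = cls y → x + y ∉ H ∧ cls (x + y) = !cls x)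
    {x₀ : G} (hx₀ : x₀ ∉ H) : H.index = 3 := by
  classical
  set a : G ⧸ H := QuotientAddGroup.mk x₀ with ha
  -- every class is `0`, `a` or `-a`
  have hall : ∀ q : G ⧸ H, q = 0 ∨ q = a ∨ q = -a := by
    intro q
    induction q using QuotientAddGroup.induction_on with
    | H y =>
      by_cases hy : y ∈ H
      · exact Or.inl ((QuotientAddGroup.eq_zero_iff y).mpr hy)
      · by_cases hc : cls y = cls x₀
        · refine Or.inr (Or.inl ?_)
          rw [ha, QuotientAddGroup.eq_iff_sub_mem, sub_eq_add_neg]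
          refine add_mem_of_cls_ne H cls hsame hy (hneg x₀ hx₀).1 ?_
          rw [(hneg x₀ hx₀).2, hc]
          cases cls x₀ <;> simp
        · refine Or.inr (Or.inr ?_)
          rw [ha, ← QuotientAddGroup.mk_neg, QuotientAddGroup.eq_iff_sub_mem, sub_neg_eq_add]
          exact add_mem_of_cls_ne H cls hsame hy hx₀ hc
  -- the three classes are distinct
  have ha0 : a ≠ 0 := fun h => hx₀ ((QuotientAddGroup.eq_zero_iff x₀).mp h)
  have hna0 : -a ≠ 0 := neg_ne_zero.mpr ha0
  have hana : a ≠ -a := by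
    intro h
    have h2 : a + a = 0 := by
      nth_rw 2 [h]
      exact add_neg_cancel a
    rw [ha, ← QuotientAddGroup.mk_add, QuotientAddGroup.eq_zero_iff] at h2
    exact (hsame x₀ x₀ hx₀ hx₀ rfl).1 h2
  -- count
  haveI : Finite (G ⧸ H) := by
    let f : Fin 3 → G ⧸ H := fun i => if i = 0 then 0 else if i = 1 then a else -a
    refine Finite.of_surjective f fun q => ?_
    rcases hall q with rfl | rfl | rfl
    exacts [⟨0, by simp [f]⟩, ⟨1, by simp [f]⟩, ⟨2, by simp [f]⟩]
  letI := Fintype.ofFinite (G ⧸ H)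
  rw [AddSubgroup.index, Nat.card_eq_fintype_card, ← Finset.card_univ, Finset.card_eq_three]
  refine ⟨0, a, -a, ha0.symm, hna0.symm, hana, ?_⟩
  ext q
  simp only [Finset.mem_univ, Finset.mem_insert, Finset.mem_singleton, true_iff]
  exact hall q

end LocalIndex

end Literature.NumberTheory.EllipticCurves
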